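import Literature.Analysis.FluidPDE.NSRobustnessOfRegularityH2SmoothingWindow
import HarnessLib

/-!
# Robustness of regularity on `ℝ³`, smoothing vein V: the packaged HYBRID sup-norm door on a
# window — `H¹` certificate on `[t₀, t₁]`, `H²` by smoothing, Agmon readout on `[(t₀+t₁)/2, t₁]`

Analysis/FluidPDE proof file (theorems only; no definitions, no named facts, no `sorry`); eighth
file of the vein `NSRobustnessOfRegularity` → `…H2` → `…SupNorm` → `…HalfFlux` → `…Dissipation` →
`…H2Smoothing` → `…H2SmoothingWindow`. The twin of lit g17's packaged door
`classicalNS_norm_sub_le_strain_window_half_R3` (`NSRobustnessOfRegularitySupNorm`) with the `H²`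
certificate inputs `D₂ ≥ Z(t₀)`, `β₂e^{Λ₂}(D₂ + Ψ₂)h ≤ 1/2` REPLACED by the dissipation-budget inputs
of the smoothing letter: `H₀ ≥ ∫‖f − g‖²`, `D ≥ X₁(t₀) + ∫_{t₀}^{t₁} φ`,
`β₂e^{Λ₂}(2D/(νh) + Ψ₂)h ≤ 1/2` (`h = t₁ − t₀`, `φ = (4G + 3κσ₂)X₁ + 4A⁴X₁³/ν³ + 4H₀/ν + 3σ₂L²/κ`).
No `H²` datum defect is asked; the conclusion holds on the SECOND HALF of the window.

* `classicalNS_norm_sub_le_strain_smoothing_window_half_R3` — for two classical solutions `(u, p)`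
  (force `f`, the reference) and `(v, q)` (force `g`) of the `L²`-Sobolev class on `[t₀, t₁] × ℝ³`,
  continuous majorants `G, σ₂, σ₃, L, X₁, H₀, H₁, ψ₁, ψ₂`, `H¹` defect inputs `D₁ ≥ ∫|∇(v − u)(t₀)|²_F`,
  `Ψ₁ ≥ ∫ψ₁`, half-smallness `2β₁e^{2Λ₁(t₁)}(D₁ + Ψ₁)²h ≤ 1/2` with `X₁ ≥ √2·e^{Λ₁}(D₁ + Ψ₁)`
  (`Λ₁ = ∫(4G + 3κσ₂)`, `β₁ = A⁴/(2ν³)`), budget `D`, `Ψ₂ ≥ ∫ψ₂` and the smoothing half-smallness: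
  for `t ∈ [(t₀ + t₁)/2, t₁]` and every `x`,
  `‖v(t,x) − u(t,x)‖ ≤ A(3X₁(t)·2e^{Λ₂(t)}(2D/(νh) + Ψ₂))^{1/4}`
  (`Λ₂(t) = ∫_{t₀}^{t}(6G + 9κσ₂ + 3κ²σ₃ + 3A²X₁/(νμ) + 27A⁴X₁²/(16ν³))`, `A = agmonConst`).
  The `H¹` letter `classicalNS_robustness_strain_window_of_le_R3` supplies `∫|∇(v − u)(s)|²_F ≤ X₁(s)`;
  the smoothing letter `classicalNS_H2_smoothing_strain_window_half_R3` the `H²` defect; Agmon reads out.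
* `classicalNS_norm_sub_le_H2_smoothing_subwindow_R3` — SLIDING-WINDOW form: class hypotheses and
  majorants (incl. `X₁ ≥ ∫|∇(v − u)|²_F`, e.g. from the `H¹` letter run once on the long slab) on
  `[T₀, T₁]`, smoothing on a short `[t₀, t₁] ⊆ [T₀, T₁]`, readout on `[(t₀ + t₁)/2, t₁]`
  (restriction by `IsClassicalNSSolutionOn.mono` / `timeDerivWithin_eq_of_subset` done inside);
  `classicalNS_norm_sub_le_H2_smoothing_subwindow_half_R3` — its closed form under half-smallness,
  `‖v(t,x) − u(t,x)‖ ≤ A(3X₁(t)·2e^{∫_{t₀}^{t} l}η)^{1/4}` (the literal brick of the hybrid door).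

WHAT THIS IS NOT: not a statement about Navier–Stokes regularity or blow-up — a-priori calculus
between two GIVEN classical solutions; the existence half is not here. Consumer: cell `ns-blowup`,
crux 20303 `EpisodeBaseT`, the HYBRID strain door (route (A′)): for `s ≥ h` the free run's sup
distance at `s` is read on the window `[s − h, s]` from this theorem; for `s ≤ h` from the
`H²`-datum door `classicalNS_norm_sub_le_strain_window_half_R3` on `[0, h]`.

## Mathlib / tree search

Tree: `classicalNS_robustness_strain_window_of_le_R3`, `classicalNS_H2_smoothing_strain_window_half_R3`,
`classicalNS_norm_sub_le_of_H1_H2_R3`, `IsClassicalNSSolutionOn.comp_add_right`.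

## References

* J. C. Robinson, J. L. Rodrigo, W. Sadowski, *The Three-Dimensional Navier–Stokes Equations*,
  CUP 2016, Thm 1.20, Thm 6.8, Thm 9.1. [RobinsonRodrigoSadowskiCUP2016]
* M. Dashti, J. C. Robinson, SIAM J. Numer. Anal. 46 (2008) 3136–3150, Thms 1–2. [DashtiRobinson2008]
* P. Constantin, C. Foias, *Navier–Stokes Equations*, Univ. Chicago Press 1988, Ch. 10.
  [ConstantinFoias1988]
-/

noncomputable section

open MeasureTheory Set Function Filter Topology InnerProductSpace
open scoped ENNReal NNReal ContDiff RealInnerProductSpace Laplacian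

namespace Literature.Analysis.FluidPDE

section HybridSupDoor

variable {ν t₀ t₁ : ℝ} {f g u v : ℝ → EuclideanSpace ℝ (Fin 3) → EuclideanSpace ℝ (Fin 3)}
variable {p q : ℝ → EuclideanSpace ℝ (Fin 3) → ℝ}

/-- Slicewise Sobolev bounds translate in time (copy of the vein's private lemma). [folklore] -/
private theorem h2s_bounds_comp_add {G' : Type*} [NormedAddCommGroup G'] [NormedSpace ℝ G']
    {w : ℝ → EuclideanSpace ℝ (Fin 3) → G'} {a b s : ℝ}
    (h : ∀ n : ℕ, ∃ C : ℝ≥0, ∀ t ∈ Icc (a + s) (b + s), ∫⁻ x, ‖iteratedFDeriv ℝ n (w t) x‖ₑ ^ 2 ≤ C) :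
    ∀ n : ℕ, ∃ C : ℝ≥0, ∀ t ∈ Icc a b, ∫⁻ x, ‖iteratedFDeriv ℝ n (w (t + s)) x‖ₑ ^ 2 ≤ C :=
  fun n => (h n).imp fun _ hC t ht => hC (t + s) ⟨by linarith [ht.1], by linarith [ht.2]⟩

/-- **The packaged HYBRID sup-norm door on a window** (RRS 2016 Thm 9.1 / Dashti–Robinson 2008 Thms
1–2 in strain form, the `H²` level by parabolic smoothing, read out by Agmon): for two classical
solutions `(u, p)` (force `f`, the reference) and `(v, q)` (force `g`) of the `L²`-Sobolev class on
`[t₀, t₁] × ℝ³` (`h = t₁ − t₀ > 0`), continuous majorants `G` (compression rate of `Du`),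
`σ₂ ≥ ‖D²u‖_∞`, `σ₃ ≥ ‖D³u‖_∞`, `L ≥ ‖(v − u)(s)‖_{L²}`, `H₀ ≥ ∫‖(f − g)(s)‖²`,
`H₁ ≥ ∫‖D(f − g)(s)‖²`, sources `ψ₁ ≥ (2/ν)∫‖f − g‖² + 3σ₂L²/κ`,
`ψ₂ ≥ 27σ₂X₁/κ + 9σ₃L²/κ² + 6H₁/ν`, `H¹` inputs `D₁ ≥ ∫|∇(v − u)(t₀)|²_F`, `Ψ₁ ≥ ∫ψ₁`,
`2β₁e^{2Λ₁(t₁)}(D₁ + Ψ₁)²h ≤ 1/2` and `X₁ ≥ √2·e^{Λ₁}(D₁ + Ψ₁)` continuous; dissipation budget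
`D ≥ X₁(t₀) + ∫_{t₀}^{t₁}[(4G + 3κσ₂)X₁ + 4A⁴X₁³/ν³ + 4H₀/ν + 3σ₂L²/κ]`, `Ψ₂ ≥ ∫ψ₂`,
`β₂e^{Λ₂(t₁)}(2D/(νh) + Ψ₂)h ≤ 1/2`. Then for `t ∈ [(t₀ + t₁)/2, t₁]` and every `x`:
`‖v(t,x) − u(t,x)‖ ≤ A(3X₁(t)·2e^{Λ₂(t)}(2D/(νh) + Ψ₂))^{1/4}` — NO `H²` datum defect enters.
[cite: RobinsonRodrigoSadowskiCUP2016, Thm 9.1 and Thm 1.20; DashtiRobinson2008, Thm 1, Thm 2; ConstantinFoias1988, Ch. 10] -/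
theorem classicalNS_norm_sub_le_strain_smoothing_window_half_R3 (hν : 0 < ν) (ht₀₁ : t₀ < t₁)
    (hv : IsClassicalNSSolutionOn (Icc t₀ t₁) ν g v q)
    (hu : IsClassicalNSSolutionOn (Icc t₀ t₁) ν f u p)
    (hU : HasBoundedSobolevNormsOn (Icc t₀ t₁) u)
    (hUt : HasBoundedSobolevNormsOn (Icc t₀ t₁) (timeDerivWithin (Icc t₀ t₁) u))
    (hp : ∀ n : ℕ, ∃ C : ℝ≥0, ∀ t ∈ Icc t₀ t₁, ∫⁻ x, ‖iteratedFDeriv ℝ n (p t) x‖ₑ ^ 2 ≤ C)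
    (hV : HasBoundedSobolevNormsOn (Icc t₀ t₁) v)
    (hVt : HasBoundedSobolevNormsOn (Icc t₀ t₁) (timeDerivWithin (Icc t₀ t₁) v))
    (hq : ∀ n : ℕ, ∃ C : ℝ≥0, ∀ t ∈ Icc t₀ t₁, ∫⁻ x, ‖iteratedFDeriv ℝ n (q t) x‖ₑ ^ 2 ≤ C)
    {G σ₂ σ₃ L X₁ H₀ H₁ ψ₁ ψ₂ : ℝ → ℝ} {κ μ D₁ Ψ₁ D Ψ₂ : ℝ} (hκ : 0 < κ) (hμ : 0 < μ)
    (hG : ∀ s ∈ Icc t₀ t₁, ∀ (x ξ : EuclideanSpace ℝ (Fin 3)),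
      -⟪fderiv ℝ (u s) x ξ, ξ⟫ ≤ G s * ‖ξ‖ ^ 2)
    (hσ₂ : ∀ s ∈ Icc t₀ t₁, ∀ x, ‖iteratedFDeriv ℝ 2 (u s) x‖ ≤ σ₂ s)
    (hσ₃ : ∀ s ∈ Icc t₀ t₁, ∀ x, ‖iteratedFDeriv ℝ 3 (u s) x‖ ≤ σ₃ s)
    (hL : ∀ s ∈ Icc t₀ t₁, Real.sqrt (∫ x, ‖(v - u) s x‖ ^ 2) ≤ L s)
    (hH₀ : ∀ s ∈ Icc t₀ t₁, ∫ x, ‖f s x - g s x‖ ^ 2 ≤ H₀ s)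
    (hH₁ : ∀ s ∈ Icc t₀ t₁, ∫ x, ‖fderiv ℝ (fun y => f s y - g s y) x‖ ^ 2 ≤ H₁ s)
    (hψ₁ : ∀ s ∈ Icc t₀ t₁, 2 / ν * (∫ x, ‖f s x - g s x‖ ^ 2) + 3 * σ₂ s / κ * L s ^ 2 ≤ ψ₁ s)
    (hψ₂ : ∀ s ∈ Icc t₀ t₁,
      27 * σ₂ s / κ * X₁ s + 9 * σ₃ s / κ ^ 2 * L s ^ 2 + 6 / ν * H₁ s ≤ ψ₂ s)
    (hGc : ContinuousOn G (Icc t₀ t₁)) (hσ₂c : ContinuousOn σ₂ (Icc t₀ t₁))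
    (hσ₃c : ContinuousOn σ₃ (Icc t₀ t₁)) (hLc : ContinuousOn L (Icc t₀ t₁))
    (hX₁c : ContinuousOn X₁ (Icc t₀ t₁)) (hH₀c : ContinuousOn H₀ (Icc t₀ t₁))
    (hH₁c : ContinuousOn H₁ (Icc t₀ t₁))
    (hψ₁c : ContinuousOn ψ₁ (Icc t₀ t₁)) (hψ₂c : ContinuousOn ψ₂ (Icc t₀ t₁))
    (hD₁ : ∫ x, frobeniusNormSq (fderiv ℝ ((v - u) t₀) x) ≤ D₁)
    (hΨ₁ : ∫ s in t₀..t₁, ψ₁ s ≤ Ψ₁)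
    (hhalf₁ : 2 * (agmonConst ^ 4 / (2 * ν ^ 3) *
        Real.exp (2 * ∫ s in t₀..t₁, (4 * G s + 3 * κ * σ₂ s))) * (D₁ + Ψ₁) ^ 2 * (t₁ - t₀) ≤ 1 / 2)
    (hX₁ : ∀ s ∈ Icc t₀ t₁,
      Real.sqrt 2 * (Real.exp (∫ r in t₀..s, (4 * G r + 3 * κ * σ₂ r)) * (D₁ + Ψ₁)) ≤ X₁ s)
    (hD : X₁ t₀ + ∫ s in t₀..t₁, ((4 * G s + 3 * κ * σ₂ s) * X₁ s +
        4 * agmonConst ^ 4 * X₁ s ^ 3 / ν ^ 3 + 4 / ν * H₀ s + 3 * σ₂ s / κ * L s ^ 2) ≤ D)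
    (hΨ₂ : ∫ s in t₀..t₁, ψ₂ s ≤ Ψ₂)
    (hhalf₃ : agmonConst ^ 2 * μ / ν *
        Real.exp (∫ s in t₀..t₁, (6 * G s + 9 * κ * σ₂ s + 3 * κ ^ 2 * σ₃ s +
          3 * agmonConst ^ 2 * X₁ s / (ν * μ) + 27 * agmonConst ^ 4 * X₁ s ^ 2 / (16 * ν ^ 3))) *
      (2 * D / (ν * (t₁ - t₀)) + Ψ₂) * (t₁ - t₀) ≤ 1 / 2)
    {t : ℝ} (ht : t ∈ Icc ((t₀ + t₁) / 2) t₁) (x : EuclideanSpace ℝ (Fin 3)) :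
    ‖v t x - u t x‖ ≤ agmonConst * (3 * X₁ t *
      (2 * Real.exp (∫ s in t₀..t, (6 * G s + 9 * κ * σ₂ s + 3 * κ ^ 2 * σ₃ s +
          3 * agmonConst ^ 2 * X₁ s / (ν * μ) + 27 * agmonConst ^ 4 * X₁ s ^ 2 / (16 * ν ^ 3))) *
        (2 * D / (ν * (t₁ - t₀)) + Ψ₂))) ^ (1 / 4 : ℝ) := by
  -- abbreviations and signs
  obtain ⟨c₁, hc₁⟩ : ∃ c₁ : ℝ, c₁ = 2 * (agmonConst ^ 4 / (2 * ν ^ 3) *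
      Real.exp (2 * ∫ s in t₀..t₁, (4 * G s + 3 * κ * σ₂ s))) := ⟨_, rfl⟩
  have hA0 : 0 ≤ agmonConst := agmonConst_nonneg
  have hc₁0 : 0 ≤ c₁ := by rw [hc₁]; positivity
  rw [← hc₁] at hhalf₁
  have hσ₂0 : ∀ s ∈ Icc t₀ t₁, 0 ≤ σ₂ s := fun s hs => (norm_nonneg _).trans (hσ₂ s hs 0)
  have hψ₁0 : ∀ s ∈ Icc t₀ t₁, 0 ≤ ψ₁ s := fun s hs => by
    refine le_trans ?_ (hψ₁ s hs)
    have : 0 ≤ ∫ x, ‖f s x - g s x‖ ^ 2 := integral_nonneg fun x => sq_nonneg _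
    have := hσ₂0 s hs
    positivity
  have hη₁0 : 0 ≤ D₁ + Ψ₁ := by
    have h1 : 0 ≤ D₁ := (integral_nonneg fun x => frobeniusNormSq_nonneg _).trans hD₁
    have h2 : 0 ≤ Ψ₁ := (intervalIntegral.integral_nonneg ht₀₁.le hψ₁0).trans hΨ₁
    exact add_nonneg h1 h2
  have hX₁0 : ∀ s ∈ Icc t₀ t₁, 0 ≤ X₁ s := fun s hs => le_trans (by positivity) (hX₁ s hs)
  -- STEP 1: the `H¹` certificate gives `∫|∇(v − u)(s)|²_F ≤ X₁(s)` on the window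
  have hsmall₁ : c₁ * (D₁ + Ψ₁) ^ 2 * (t₁ - t₀) < 1 := hhalf₁.trans_lt (by norm_num)
  have hXle : ∀ s ∈ Icc t₀ t₁, ∫ x, frobeniusNormSq (fderiv ℝ ((v - u) s) x) ≤ X₁ s := by
    intro s hs
    have h1 := classicalNS_robustness_strain_window_of_le_R3 hν ht₀₁ hv hu hU hUt hp hV hVt hq hκ hG hσ₂ hL
      hψ₁ hGc hσ₂c hψ₁c hD₁ hΨ₁ (by rw [← hc₁]; exact hsmall₁) hs
    rw [← hc₁] at h1
    refine h1.trans (le_trans ?_ (hX₁ s hs))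
    have hden : 1 / 2 ≤ 1 - c₁ * (D₁ + Ψ₁) ^ 2 * (s - t₀) := by
      have : c₁ * (D₁ + Ψ₁) ^ 2 * (s - t₀) ≤ c₁ * (D₁ + Ψ₁) ^ 2 * (t₁ - t₀) :=
        mul_le_mul_of_nonneg_left (sub_le_sub_right hs.2 _) (by positivity)
      linarith
    have hsq : Real.sqrt (1 / 2) ≤ Real.sqrt (1 - c₁ * (D₁ + Ψ₁) ^ 2 * (s - t₀)) :=
      Real.sqrt_le_sqrt hden
    have hhalf : 0 < Real.sqrt (1 / 2) := Real.sqrt_pos.2 (by norm_num)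
    have hnum : 0 ≤ Real.exp (∫ r in t₀..s, (4 * G r + 3 * κ * σ₂ r)) * (D₁ + Ψ₁) := by positivity
    calc Real.exp (∫ r in t₀..s, (4 * G r + 3 * κ * σ₂ r)) * (D₁ + Ψ₁) /
          Real.sqrt (1 - c₁ * (D₁ + Ψ₁) ^ 2 * (s - t₀))
        ≤ Real.exp (∫ r in t₀..s, (4 * G r + 3 * κ * σ₂ r)) * (D₁ + Ψ₁) / Real.sqrt (1 / 2) :=
          div_le_div_of_nonneg_left hnum hhalf hsq
      _ = Real.sqrt 2 * (Real.exp (∫ r in t₀..s, (4 * G r + 3 * κ * σ₂ r)) * (D₁ + Ψ₁)) := by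
          have h2 : Real.sqrt (1 / 2) = 1 / Real.sqrt 2 := by
            rw [Real.sqrt_div' _ (by norm_num : (0 : ℝ) ≤ 2), Real.sqrt_one]
          rw [h2]
          field_simp
  -- STEP 2: the `H²` defect at `t` by smoothing (no `H²` datum)
  have hZ := classicalNS_H2_smoothing_strain_window_half_R3 hν ht₀₁ hv hu hU hUt hp hV hVt hq hκ hμ hG hσ₂
    hσ₃ hL hXle hH₀ hH₁ hψ₂ hGc hσ₂c hσ₃c hLc hX₁c hH₀c hH₁c hψ₂c hD hΨ₂ hhalf₃ ht
  -- STEP 3: Agmon readout on the slice `t`, after translating the window to `[0, t₁ − t₀]`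
  have ht' : t ∈ Icc t₀ t₁ := ⟨le_trans (by linarith) ht.1, ht.2⟩
  have hpre : (fun s => s + t₀) ⁻¹' Icc t₀ t₁ = Icc 0 (t₁ - t₀) := by
    rw [Set.preimage_add_const_Icc, sub_self]
  have hu' : IsClassicalNSSolutionOn (Icc 0 (t₁ - t₀)) ν (fun s => f (s + t₀)) (fun s => u (s + t₀))
      (fun s => p (s + t₀)) := by
    have h := hu.comp_add_right t₀
    rwa [hpre] at h
  have hv' : IsClassicalNSSolutionOn (Icc 0 (t₁ - t₀)) ν (fun s => g (s + t₀)) (fun s => v (s + t₀))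
      (fun s => q (s + t₀)) := by
    have h := hv.comp_add_right t₀
    rwa [hpre] at h
  have hIcc : Icc t₀ t₁ = Icc (0 + t₀) (t₁ - t₀ + t₀) := by rw [zero_add, sub_add_cancel]
  have hU' : HasBoundedSobolevNormsOn (Icc 0 (t₁ - t₀)) (fun s => u (s + t₀)) := by
    rw [hIcc] at hU
    exact h2s_bounds_comp_add hU
  have hV' : HasBoundedSobolevNormsOn (Icc 0 (t₁ - t₀)) (fun s => v (s + t₀)) := by
    rw [hIcc] at hV
    exact h2s_bounds_comp_add hV
  have hr : t - t₀ ∈ Icc 0 (t₁ - t₀) := ⟨sub_nonneg.2 ht'.1, sub_le_sub_right ht'.2 _⟩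
  have e1 : ((fun s => v (s + t₀)) - fun s => u (s + t₀)) (t - t₀) = (v - u) t := by
    funext y
    simp only [Pi.sub_apply, sub_add_cancel]
  have hX0 : 0 ≤ X₁ t := hX₁0 t ht'
  have h := classicalNS_norm_sub_le_of_H1_H2_R3 hv' hu' hU' hV' hr
    (X₁ := X₁ t) (by rw [e1]; exact hXle t ht') le_rfl x
  rw [e1] at h
  simp only [sub_add_cancel] at h
  refine h.trans (mul_le_mul_of_nonneg_left (Real.rpow_le_rpow ?_ ?_ (by norm_num)) hA0)
  · exact mul_nonneg (mul_nonneg (by norm_num) hX0)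
      (Finset.sum_nonneg fun i _ => integral_nonneg fun y => frobeniusNormSq_nonneg _)
  · exact mul_le_mul_of_nonneg_left hZ (mul_nonneg (by norm_num) hX0)

/-- **Sliding-window form** (the shape the HYBRID strain door uses): class hypotheses and majorants
on a LONG slab `[T₀, T₁]` (where the `H¹` letter runs and supplies the continuous majorant
`X₁ ≥ ∫|∇(v − u)|²_F`), smoothing on a SHORT sub-window `[t₀, t₁] ⊆ [T₀, T₁]`, readout on its second
half: for `t ∈ [(t₀ + t₁)/2, t₁]` and every `x`,
`‖v(t,x) − u(t,x)‖ ≤ A(3X₁(t)·e^{∫_{t₀}^{t} l}η/(1 − βe^{∫_{t₀}^{t₁} l}ηh))^{1/4}`,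
`η = 2D/(νh) + Ψ₂`, `D ≥ X₁(t₀) + ∫_{t₀}^{t₁} φ`, `Ψ₂ ≥ ∫_{t₀}^{t₁} ψ`, `h = t₁ − t₀` (the class
hypotheses are restricted to the sub-window by `IsClassicalNSSolutionOn.mono` and
`IsSmoothSpaceTimeOn.timeDerivWithin_eq_of_subset`). [cite: ConstantinFoias1988, Ch. 10 (proof of Thm 10.6); DashtiRobinson2008, Thm 2; RobinsonRodrigoSadowskiCUP2016, Thm 1.20] -/
theorem classicalNS_norm_sub_le_H2_smoothing_subwindow_R3 {T₀ T₁ : ℝ} (hν : 0 < ν)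
    (hTt₀ : T₀ ≤ t₀) (ht₀₁ : t₀ < t₁) (htT₁ : t₁ ≤ T₁)
    (hv : IsClassicalNSSolutionOn (Icc T₀ T₁) ν g v q)
    (hu : IsClassicalNSSolutionOn (Icc T₀ T₁) ν f u p)
    (hU : HasBoundedSobolevNormsOn (Icc T₀ T₁) u)
    (hUt : HasBoundedSobolevNormsOn (Icc T₀ T₁) (timeDerivWithin (Icc T₀ T₁) u))
    (hp : ∀ n : ℕ, ∃ C : ℝ≥0, ∀ t ∈ Icc T₀ T₁, ∫⁻ x, ‖iteratedFDeriv ℝ n (p t) x‖ₑ ^ 2 ≤ C)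
    (hV : HasBoundedSobolevNormsOn (Icc T₀ T₁) v)
    (hVt : HasBoundedSobolevNormsOn (Icc T₀ T₁) (timeDerivWithin (Icc T₀ T₁) v))
    (hq : ∀ n : ℕ, ∃ C : ℝ≥0, ∀ t ∈ Icc T₀ T₁, ∫⁻ x, ‖iteratedFDeriv ℝ n (q t) x‖ₑ ^ 2 ≤ C)
    {G σ₂ σ₃ L X₁ H₀ H₁ ψ : ℝ → ℝ} {κ μ D Ψ₂ : ℝ} (hκ : 0 < κ) (hμ : 0 < μ)
    (hG : ∀ s ∈ Icc T₀ T₁, ∀ (x ξ : EuclideanSpace ℝ (Fin 3)),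
      -⟪fderiv ℝ (u s) x ξ, ξ⟫ ≤ G s * ‖ξ‖ ^ 2)
    (hσ₂ : ∀ s ∈ Icc T₀ T₁, ∀ x, ‖iteratedFDeriv ℝ 2 (u s) x‖ ≤ σ₂ s)
    (hσ₃ : ∀ s ∈ Icc T₀ T₁, ∀ x, ‖iteratedFDeriv ℝ 3 (u s) x‖ ≤ σ₃ s)
    (hL : ∀ s ∈ Icc T₀ T₁, Real.sqrt (∫ x, ‖(v - u) s x‖ ^ 2) ≤ L s)
    (hX₁ : ∀ s ∈ Icc T₀ T₁, ∫ x, frobeniusNormSq (fderiv ℝ ((v - u) s) x) ≤ X₁ s)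
    (hH₀ : ∀ s ∈ Icc T₀ T₁, ∫ x, ‖f s x - g s x‖ ^ 2 ≤ H₀ s)
    (hH₁ : ∀ s ∈ Icc T₀ T₁, ∫ x, ‖fderiv ℝ (fun y => f s y - g s y) x‖ ^ 2 ≤ H₁ s)
    (hψ : ∀ s ∈ Icc T₀ T₁,
      27 * σ₂ s / κ * X₁ s + 9 * σ₃ s / κ ^ 2 * L s ^ 2 + 6 / ν * H₁ s ≤ ψ s)
    (hGc : ContinuousOn G (Icc T₀ T₁)) (hσ₂c : ContinuousOn σ₂ (Icc T₀ T₁))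
    (hσ₃c : ContinuousOn σ₃ (Icc T₀ T₁)) (hLc : ContinuousOn L (Icc T₀ T₁))
    (hX₁c : ContinuousOn X₁ (Icc T₀ T₁)) (hH₀c : ContinuousOn H₀ (Icc T₀ T₁))
    (hH₁c : ContinuousOn H₁ (Icc T₀ T₁)) (hψc : ContinuousOn ψ (Icc T₀ T₁))
    (hD : X₁ t₀ + ∫ s in t₀..t₁, ((4 * G s + 3 * κ * σ₂ s) * X₁ s +
        4 * agmonConst ^ 4 * X₁ s ^ 3 / ν ^ 3 + 4 / ν * H₀ s + 3 * σ₂ s / κ * L s ^ 2) ≤ D)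
    (hΨ₂ : ∫ s in t₀..t₁, ψ s ≤ Ψ₂)
    (hsmall : agmonConst ^ 2 * μ / ν *
        Real.exp (∫ s in t₀..t₁, (6 * G s + 9 * κ * σ₂ s + 3 * κ ^ 2 * σ₃ s +
          3 * agmonConst ^ 2 * X₁ s / (ν * μ) + 27 * agmonConst ^ 4 * X₁ s ^ 2 / (16 * ν ^ 3))) *
      (2 * D / (ν * (t₁ - t₀)) + Ψ₂) * (t₁ - t₀) < 1)
    {t : ℝ} (ht : t ∈ Icc ((t₀ + t₁) / 2) t₁) (x : EuclideanSpace ℝ (Fin 3)) :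
    ‖v t x - u t x‖ ≤ agmonConst * (3 * X₁ t *
      (Real.exp (∫ s in t₀..t, (6 * G s + 9 * κ * σ₂ s + 3 * κ ^ 2 * σ₃ s +
          3 * agmonConst ^ 2 * X₁ s / (ν * μ) + 27 * agmonConst ^ 4 * X₁ s ^ 2 / (16 * ν ^ 3))) *
          (2 * D / (ν * (t₁ - t₀)) + Ψ₂) /
        (1 - agmonConst ^ 2 * μ / ν *
          Real.exp (∫ s in t₀..t₁, (6 * G s + 9 * κ * σ₂ s + 3 * κ ^ 2 * σ₃ s +
            3 * agmonConst ^ 2 * X₁ s / (ν * μ) + 27 * agmonConst ^ 4 * X₁ s ^ 2 / (16 * ν ^ 3))) *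
          (2 * D / (ν * (t₁ - t₀)) + Ψ₂) * (t₁ - t₀)))) ^ (1 / 4 : ℝ) := by
  -- restrict the class hypotheses to the sub-window
  have hsub : Icc t₀ t₁ ⊆ Icc T₀ T₁ := Icc_subset_Icc hTt₀ htT₁
  have hUa : UniqueDiffOn ℝ (Icc t₀ t₁) := uniqueDiffOn_Icc ht₀₁
  have hWeq : ∀ {w : ℝ → EuclideanSpace ℝ (Fin 3) → EuclideanSpace ℝ (Fin 3)},
      IsSmoothSpaceTimeOn (Icc T₀ T₁) w → ∀ s ∈ Icc t₀ t₁,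
        timeDerivWithin (Icc t₀ t₁) w s = timeDerivWithin (Icc T₀ T₁) w s := fun hw s hs =>
    funext fun x => hw.timeDerivWithin_eq_of_subset hsub hUa hs x
  have hUt' : HasBoundedSobolevNormsOn (Icc t₀ t₁) (timeDerivWithin (Icc t₀ t₁) u) := by
    intro n
    obtain ⟨C, hC⟩ := hUt n
    exact ⟨C, fun s hs => by rw [hWeq hu.smooth_velocity s hs]; exact hC s (hsub hs)⟩
  have hVt' : HasBoundedSobolevNormsOn (Icc t₀ t₁) (timeDerivWithin (Icc t₀ t₁) v) := by
    intro n
    obtain ⟨C, hC⟩ := hVt n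
    exact ⟨C, fun s hs => by rw [hWeq hv.smooth_velocity s hs]; exact hC s (hsub hs)⟩
  exact classicalNS_norm_sub_le_H2_smoothing_window_R3 hν ht₀₁ (hv.mono hsub hUa) (hu.mono hsub hUa)
    (hU.mono hsub) hUt' (fun n => (hp n).imp fun _ hC t ht => hC t (hsub ht)) (hV.mono hsub) hVt'
    (fun n => (hq n).imp fun _ hC t ht => hC t (hsub ht)) hκ hμ
    (fun s hs => hG s (hsub hs)) (fun s hs => hσ₂ s (hsub hs)) (fun s hs => hσ₃ s (hsub hs))
    (fun s hs => hL s (hsub hs)) (fun s hs => hX₁ s (hsub hs)) (fun s hs => hH₀ s (hsub hs))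
    (fun s hs => hH₁ s (hsub hs)) (fun s hs => hψ s (hsub hs))
    (hGc.mono hsub) (hσ₂c.mono hsub) (hσ₃c.mono hsub) (hLc.mono hsub) (hX₁c.mono hsub) (hH₀c.mono hsub)
    (hH₁c.mono hsub) (hψc.mono hsub) hD hΨ₂ hsmall ht x

/-- **Sliding-window form, closed under half-smallness** (the literal brick of the HYBRID door):
in the setting of `classicalNS_norm_sub_le_H2_smoothing_subwindow_R3` with
`βe^{∫_{t₀}^{t₁} l}ηh ≤ 1/2`, for `t ∈ [(t₀ + t₁)/2, t₁]` and every `x`: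
`‖v(t,x) − u(t,x)‖ ≤ A(3X₁(t)·2e^{∫_{t₀}^{t} l}η)^{1/4}`, `η = 2D/(νh) + Ψ₂`.
[cite: ConstantinFoias1988, Ch. 10 (proof of Thm 10.6); DashtiRobinson2008, Thm 2; RobinsonRodrigoSadowskiCUP2016, Thm 1.20] -/
theorem classicalNS_norm_sub_le_H2_smoothing_subwindow_half_R3 {T₀ T₁ : ℝ} (hν : 0 < ν)
    (hTt₀ : T₀ ≤ t₀) (ht₀₁ : t₀ < t₁) (htT₁ : t₁ ≤ T₁)
    (hv : IsClassicalNSSolutionOn (Icc T₀ T₁) ν g v q)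
    (hu : IsClassicalNSSolutionOn (Icc T₀ T₁) ν f u p)
    (hU : HasBoundedSobolevNormsOn (Icc T₀ T₁) u)
    (hUt : HasBoundedSobolevNormsOn (Icc T₀ T₁) (timeDerivWithin (Icc T₀ T₁) u))
    (hp : ∀ n : ℕ, ∃ C : ℝ≥0, ∀ t ∈ Icc T₀ T₁, ∫⁻ x, ‖iteratedFDeriv ℝ n (p t) x‖ₑ ^ 2 ≤ C)
    (hV : HasBoundedSobolevNormsOn (Icc T₀ T₁) v)
    (hVt : HasBoundedSobolevNormsOn (Icc T₀ T₁) (timeDerivWithin (Icc T₀ T₁) v))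
    (hq : ∀ n : ℕ, ∃ C : ℝ≥0, ∀ t ∈ Icc T₀ T₁, ∫⁻ x, ‖iteratedFDeriv ℝ n (q t) x‖ₑ ^ 2 ≤ C)
    {G σ₂ σ₃ L X₁ H₀ H₁ ψ : ℝ → ℝ} {κ μ D Ψ₂ : ℝ} (hκ : 0 < κ) (hμ : 0 < μ)
    (hG : ∀ s ∈ Icc T₀ T₁, ∀ (x ξ : EuclideanSpace ℝ (Fin 3)),
      -⟪fderiv ℝ (u s) x ξ, ξ⟫ ≤ G s * ‖ξ‖ ^ 2)
    (hσ₂ : ∀ s ∈ Icc T₀ T₁, ∀ x, ‖iteratedFDeriv ℝ 2 (u s) x‖ ≤ σ₂ s)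
    (hσ₃ : ∀ s ∈ Icc T₀ T₁, ∀ x, ‖iteratedFDeriv ℝ 3 (u s) x‖ ≤ σ₃ s)
    (hL : ∀ s ∈ Icc T₀ T₁, Real.sqrt (∫ x, ‖(v - u) s x‖ ^ 2) ≤ L s)
    (hX₁ : ∀ s ∈ Icc T₀ T₁, ∫ x, frobeniusNormSq (fderiv ℝ ((v - u) s) x) ≤ X₁ s)
    (hH₀ : ∀ s ∈ Icc T₀ T₁, ∫ x, ‖f s x - g s x‖ ^ 2 ≤ H₀ s)
    (hH₁ : ∀ s ∈ Icc T₀ T₁, ∫ x, ‖fderiv ℝ (fun y => f s y - g s y) x‖ ^ 2 ≤ H₁ s)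
    (hψ : ∀ s ∈ Icc T₀ T₁,
      27 * σ₂ s / κ * X₁ s + 9 * σ₃ s / κ ^ 2 * L s ^ 2 + 6 / ν * H₁ s ≤ ψ s)
    (hGc : ContinuousOn G (Icc T₀ T₁)) (hσ₂c : ContinuousOn σ₂ (Icc T₀ T₁))
    (hσ₃c : ContinuousOn σ₃ (Icc T₀ T₁)) (hLc : ContinuousOn L (Icc T₀ T₁))
    (hX₁c : ContinuousOn X₁ (Icc T₀ T₁)) (hH₀c : ContinuousOn H₀ (Icc T₀ T₁))
    (hH₁c : ContinuousOn H₁ (Icc T₀ T₁)) (hψc : ContinuousOn ψ (Icc T₀ T₁))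
    (hD : X₁ t₀ + ∫ s in t₀..t₁, ((4 * G s + 3 * κ * σ₂ s) * X₁ s +
        4 * agmonConst ^ 4 * X₁ s ^ 3 / ν ^ 3 + 4 / ν * H₀ s + 3 * σ₂ s / κ * L s ^ 2) ≤ D)
    (hΨ₂ : ∫ s in t₀..t₁, ψ s ≤ Ψ₂)
    (hhalf : agmonConst ^ 2 * μ / ν *
        Real.exp (∫ s in t₀..t₁, (6 * G s + 9 * κ * σ₂ s + 3 * κ ^ 2 * σ₃ s +
          3 * agmonConst ^ 2 * X₁ s / (ν * μ) + 27 * agmonConst ^ 4 * X₁ s ^ 2 / (16 * ν ^ 3))) *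
      (2 * D / (ν * (t₁ - t₀)) + Ψ₂) * (t₁ - t₀) ≤ 1 / 2)
    {t : ℝ} (ht : t ∈ Icc ((t₀ + t₁) / 2) t₁) (x : EuclideanSpace ℝ (Fin 3)) :
    ‖v t x - u t x‖ ≤ agmonConst * (3 * X₁ t *
      (2 * Real.exp (∫ s in t₀..t, (6 * G s + 9 * κ * σ₂ s + 3 * κ ^ 2 * σ₃ s +
          3 * agmonConst ^ 2 * X₁ s / (ν * μ) + 27 * agmonConst ^ 4 * X₁ s ^ 2 / (16 * ν ^ 3))) *
        (2 * D / (ν * (t₁ - t₀)) + Ψ₂))) ^ (1 / 4 : ℝ) := by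
  -- restrict the class hypotheses to the sub-window
  have hsub : Icc t₀ t₁ ⊆ Icc T₀ T₁ := Icc_subset_Icc hTt₀ htT₁
  have hUa : UniqueDiffOn ℝ (Icc t₀ t₁) := uniqueDiffOn_Icc ht₀₁
  have hWeq : ∀ {w : ℝ → EuclideanSpace ℝ (Fin 3) → EuclideanSpace ℝ (Fin 3)},
      IsSmoothSpaceTimeOn (Icc T₀ T₁) w → ∀ s ∈ Icc t₀ t₁,
        timeDerivWithin (Icc t₀ t₁) w s = timeDerivWithin (Icc T₀ T₁) w s := fun hw s hs =>
    funext fun x => hw.timeDerivWithin_eq_of_subset hsub hUa hs x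
  have hUt' : HasBoundedSobolevNormsOn (Icc t₀ t₁) (timeDerivWithin (Icc t₀ t₁) u) := by
    intro n
    obtain ⟨C, hC⟩ := hUt n
    exact ⟨C, fun s hs => by rw [hWeq hu.smooth_velocity s hs]; exact hC s (hsub hs)⟩
  have hVt' : HasBoundedSobolevNormsOn (Icc t₀ t₁) (timeDerivWithin (Icc t₀ t₁) v) := by
    intro n
    obtain ⟨C, hC⟩ := hVt n
    exact ⟨C, fun s hs => by rw [hWeq hv.smooth_velocity s hs]; exact hC s (hsub hs)⟩
  have hv' : IsClassicalNSSolutionOn (Icc t₀ t₁) ν g v q := hv.mono hsub hUa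
  have hu' : IsClassicalNSSolutionOn (Icc t₀ t₁) ν f u p := hu.mono hsub hUa
  -- the `H²` defect on the sub-window by smoothing, closed form
  have hZ := classicalNS_H2_smoothing_strain_window_half_R3 hν ht₀₁ hv' hu' (hU.mono hsub) hUt'
    (fun n => (hp n).imp fun _ hC t ht => hC t (hsub ht)) (hV.mono hsub) hVt'
    (fun n => (hq n).imp fun _ hC t ht => hC t (hsub ht)) hκ hμ
    (fun s hs => hG s (hsub hs)) (fun s hs => hσ₂ s (hsub hs)) (fun s hs => hσ₃ s (hsub hs))
    (fun s hs => hL s (hsub hs)) (fun s hs => hX₁ s (hsub hs)) (fun s hs => hH₀ s (hsub hs))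
    (fun s hs => hH₁ s (hsub hs)) (fun s hs => hψ s (hsub hs))
    (hGc.mono hsub) (hσ₂c.mono hsub) (hσ₃c.mono hsub) (hLc.mono hsub) (hX₁c.mono hsub) (hH₀c.mono hsub)
    (hH₁c.mono hsub) (hψc.mono hsub) hD hΨ₂ hhalf ht
  -- Agmon readout on the slice `t` after translating `[t₀, t₁]` to `[0, t₁ − t₀]`
  have ht' : t ∈ Icc t₀ t₁ := ⟨le_trans (by linarith) ht.1, ht.2⟩
  have hpre : (fun s => s + t₀) ⁻¹' Icc t₀ t₁ = Icc 0 (t₁ - t₀) := by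
    rw [Set.preimage_add_const_Icc, sub_self]
  have hu'' : IsClassicalNSSolutionOn (Icc 0 (t₁ - t₀)) ν (fun s => f (s + t₀)) (fun s => u (s + t₀))
      (fun s => p (s + t₀)) := by
    have h := hu'.comp_add_right t₀
    rwa [hpre] at h
  have hv'' : IsClassicalNSSolutionOn (Icc 0 (t₁ - t₀)) ν (fun s => g (s + t₀)) (fun s => v (s + t₀))
      (fun s => q (s + t₀)) := by
    have h := hv'.comp_add_right t₀
    rwa [hpre] at h
  have hIcc : Icc t₀ t₁ = Icc (0 + t₀) (t₁ - t₀ + t₀) := by rw [zero_add, sub_add_cancel]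
  have hU'' : HasBoundedSobolevNormsOn (Icc 0 (t₁ - t₀)) (fun s => u (s + t₀)) := by
    have h := hU.mono hsub
    rw [hIcc] at h
    exact h2s_bounds_comp_add h
  have hV'' : HasBoundedSobolevNormsOn (Icc 0 (t₁ - t₀)) (fun s => v (s + t₀)) := by
    have h := hV.mono hsub
    rw [hIcc] at h
    exact h2s_bounds_comp_add h
  have hr : t - t₀ ∈ Icc 0 (t₁ - t₀) := ⟨sub_nonneg.2 ht'.1, sub_le_sub_right ht'.2 _⟩
  have e1 : ((fun s => v (s + t₀)) - fun s => u (s + t₀)) (t - t₀) = (v - u) t := by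
    funext y
    simp only [Pi.sub_apply, sub_add_cancel]
  have hX0 : 0 ≤ X₁ t :=
    (integral_nonneg fun y => frobeniusNormSq_nonneg _).trans (hX₁ t (hsub ht'))
  have h := classicalNS_norm_sub_le_of_H1_H2_R3 hv'' hu'' hU'' hV'' hr
    (X₁ := X₁ t) (by rw [e1]; exact hX₁ t (hsub ht')) le_rfl x
  rw [e1] at h
  simp only [sub_add_cancel] at h
  refine h.trans (mul_le_mul_of_nonneg_left (Real.rpow_le_rpow ?_ ?_ (by norm_num)) agmonConst_nonneg)
  · exact mul_nonneg (mul_nonneg (by norm_num) hX0)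
      (Finset.sum_nonneg fun i _ => integral_nonneg fun y => frobeniusNormSq_nonneg _)
  · exact mul_le_mul_of_nonneg_left hZ (mul_nonneg (by norm_num) hX0)

end HybridSupDoor

end Literature.Analysis.FluidPDE
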